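import Mathlib
import HarnessLib
import Summits.HubbardSuperconductivity.HubbardSuperconductivity.Theorems.KLProgrammeKLRegimeTwoVolumeLipDoubledIdentity
import Summits.HubbardSuperconductivity.HubbardSuperconductivity.Theorems.KLProgrammeKLRegimeTwoVolumeLipDoubledTransferRows
import Summits.HubbardSuperconductivity.HubbardSuperconductivity.Theorems.KLProgrammeKLRegimeTwoVolumeSubstitutionGluingDeepPin
import Summits.HubbardSuperconductivity.HubbardSuperconductivity.Theorems.KLProgrammeKLRegimeTwoVolumeTransferTailsWt
import Summits.HubbardSuperconductivity.HubbardSuperconductivity.Theorems.KLProgrammeKLRegimeTwoVolumeLipJumpRows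

/-!
# Route `KLProgramme` — crux K3 ENGINE (stmt-HubbardSuperconductivity-20437), stub (e) proof-input «(e)-D-ROWS», keying (A′), REKEY-D file D3b (part 2):
# THE SOURCE TRANSFER DOOR OF THE DOUBLED (plain-track) TWO-VOLUME LIPSCHITZ TOWER — the generic gluing door ✓ `TwoVolumeDefect.sum_norm_kernel_map_sub_glue_map_le_of_defect` at
# `e := klBlockEquivD`, `T⁺ = T ⊕ shift` (seat hubbard-kl-k3c4-p1 g27; doubled twin of ✓ `…TwoVolumeLipSourceTransfer.lipSourceTransfer_le`)

* **`lipSourceTransferD_le_of_wtRows`** (§4) — the same with the nine transfer data DISCHARGED from E1's two `(1 + Λ_T·tnorm)`-weighted sums `cW` (`1 ≤ cW`) of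
  `klLipTransfer (bL) = klJump (bL) (dk) (dk−1)` (✓ `klJump_periodise`, ✓ `norm_klJump_blockCovariant`, ✓ `…TransferTailsWt`), `Z/Near/NearF` the `tnorm` predicates of
  ✓ `klGlue_transfer_le_of_wtRows`, and the plain-pin partner facts discharged (same site ⇒ `tnorm 0`);
* **`lipSourceTransferD_le`** — the pinned profile of the doubled SOURCE `map T′⁺ (born⁺_{bL}(klGlueD D_L)) − klGlueD (klLipBornD L … d k)` (D1 `klLipBornDiffD_eq_lip_add_src`,
  `klLipBornD_eq_map_step`) is `≤ aⁿ(aE + τ·ND) + (2aⁿτN + n·aⁿ(5τN + 2a·N_far))` from: the SECTOR transfer data of `klLipTransfer (bL)` (`hcol hwin hρ hrowF hτF hτ₁ hτ₂ hτ₃ hτ₄`,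
  `1 ≤ a`; the copy-`0`-only data `hρ hτ₂ hτ₃` are asked only when the pin is alive), the plain-pin partner facts `hWF`, `hW₃`, the coarse doubled born profiles `N, N_far` and the doubled
  source-defect profiles `E, ND` (covariance = spectator lift of the sector defect, ✓ D3 `klLipDefectD_apply`).

Composition of landed theorems; every profile / row is a hypothesis; nothing asserts the (D) rows, (e), VL, K3 or superconductivity.
References: BGM 2006 §2.7 (2.70)–(2.71), §2.9 (4.3)–(4.6) [cite: BenfattoGiulianiMastropietro2006]; Salmhofer 1999 App. B.2.
-/

noncomputable section

namespace Summit.HubbardSuperconductivity.HubbardSuperconductivity.Theorems.TwoVolumeLip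

set_option linter.dupNamespace false -- summit = problem name (single-conjunct summit), D-0017

open Finset Literature.MathematicalPhysics.QuantumLattice GrassmannAlgebra Literature.Probability.LatticeModels
open Literature.MathematicalPhysics.QuantumLattice.FermiRG
open Summit.HubbardSuperconductivity.HubbardSuperconductivity.Theorems.KLRegimeSplit
open Summit.HubbardSuperconductivity.HubbardSuperconductivity.Theorems.KLProgrammeLegKernels
open Summit.HubbardSuperconductivity.HubbardSuperconductivity.Theorems.EngineV8
open Summit.HubbardSuperconductivity.HubbardSuperconductivity.Theorems.TwoVolumeSource
open Summit.HubbardSuperconductivity.HubbardSuperconductivity.Theorems.TwoVolumeDefect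

/-! ## D3b §3 THE SOURCE TRANSFER DOOR OF THE DOUBLED TOWER (the generic gluing door at `e := klBlockEquivD`, `T⁺ = T ⊕ shift`) -/

section SourceDoorD

variable {L b M : ℕ} [NeZero L] [NeZero (b * L)] [NeZero M]

/-- **THE SOURCE OF THE DOUBLED BLOCK STEP, BOUNDED** (doubled twin of ✓ `…TwoVolumeLipSourceTransfer.lipSourceTransfer_le`): the generic gluing door
`TwoVolumeDefect.sum_norm_kernel_map_sub_glue_map_le_of_defect` at `e₁ := klBlockEquivD … (dk−1)`, `e₂ := klBlockEquivD … (dk)`, `Fe := klBlockEmbD`, `T := klLipTransferD L`,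
`T′ := klLipTransferD (bL)` (periodisation `klLipTransferD_periodise`), `W′ := born⁺_{bL}(klGlueD (klLipInputD L))`, `W := born⁺_L (klLipInputD L)`.  Transfer data = the SECTOR
data of `klLipTransfer (bL)` (`hcol hwin hρ hrowF hτF hτ₁ hτ₂ hτ₃ hτ₄`, with `1 ≤ a`) plus, at a PLAIN pin (`w′.2 = 1`), the partner facts `hWF`, `hW₃` (the shift's unique partner is
near); kernel data `N, Nfar` (coarse doubled born profiles, `Far`/`Z`/`Near` read on the position-sector component) and `E, ND` (doubled source-defect profiles).
Output: the pinned profile of `map T′⁺ W′ − klGlueD (klLipBornD L … d k)` at `(p, w′)` is `≤ aⁿ(aE + τND) + (2aⁿτN + n·aⁿ(5τN + 2aN_far))`. [cite: BenfattoGiulianiMastropietro2006, §2.7 (2.70)-(2.71), §2.9 (4.3)-(4.6)] -/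
theorem lipSourceTransferD_le {β : ℝ} (hβ : β ≠ 0) (U μ : ℝ) (K : TrigPolyC4v) {d k : ℕ} (hdk : 1 ≤ d * k)
    (hZc : hubbardEffPartitionFnCT L M β U μ 0 K (klScale klE0 (d * k)) ≠ 0)
    {n : ℕ} (p : Fin (n + 1)) (w' : SrcLabel (b * L) M (d * k))
    (Z Near : SpaceTimeIdx L M × SectorLeg (sectorCount (d * k - 1)) → Prop) [DecidablePred Z] [DecidablePred Near]
    (Far : SpaceTimeIdx L M × SectorLeg (sectorCount (d * k - 1)) → SpaceTimeIdx L M × SectorLeg (sectorCount (d * k - 1)) → Prop)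
    [DecidableRel Far] (hZ : ∀ y y', Near y → Z y' → Far y y')
    (NearF : SpaceTimeIdx (b * L) M × SectorLeg (sectorCount (d * k - 1)) → Prop) [DecidablePred NearF]
    {a τ N Nfar E ND : ℝ} (ha1 : 1 ≤ a) (hτ0 : 0 ≤ τ) (hN0 : 0 ≤ N) (hNfar0 : 0 ≤ Nfar) (hE0 : 0 ≤ E) (hND0 : 0 ≤ ND)
    (hcol : ∀ y', ∑ x, ‖klLipTransfer (b * L) M β μ K d k x y'‖ ≤ a)
    (hwin : ∀ (B' : Fin 2 → Fin b) (y : SpaceTimeIdx L M × SectorLeg (sectorCount (d * k - 1))),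
      ∑ B : Fin 2 → Fin b, ∑ x ∈ univ.filter (fun x : SpaceTimeIdx (b * L) M × SectorLeg (sectorCount (d * k)) =>
          (klBlockEquiv L b M (sectorCount (d * k)) x).1 = B'),
        ‖klLipTransfer (b * L) M β μ K d k x ((klBlockEquiv L b M (sectorCount (d * k - 1))).symm (B, y))‖ ≤ a)
    (hρ : w'.2 = 0 → ∑ y, ‖klLipTransfer (b * L) M β μ K d k w'.1
        ((klBlockEquiv L b M (sectorCount (d * k - 1))).symm ((klBlockEquiv L b M (sectorCount (d * k)) w'.1).1, y))‖ ≤ a)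
    (hrowF : ∑ y' ∈ univ.filter (fun y' : SpaceTimeIdx (b * L) M × SectorLeg (sectorCount (d * k - 1)) => NearF y'),
      ‖klLipTransfer (b * L) M β μ K d k w'.1 y'‖ ≤ a)
    (hτF : ∑ y' ∈ univ.filter (fun y' : SpaceTimeIdx (b * L) M × SectorLeg (sectorCount (d * k - 1)) => ¬ NearF y'),
      ‖klLipTransfer (b * L) M β μ K d k w'.1 y'‖ ≤ τ)
    (hWF : w'.2 = 1 → ∀ y', klPlainShift (b * L) M (sectorCount (d * k)) (sectorCount (d * k - 1)) w'.1 y' ≠ 0 → NearF y')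
    (hτ₁ : ∀ y, ¬ Z y → ∑ x ∈ univ.filter (fun x : SpaceTimeIdx (b * L) M × SectorLeg (sectorCount (d * k)) =>
        (klBlockEquiv L b M (sectorCount (d * k)) x).1 ≠ (klBlockEquiv L b M (sectorCount (d * k)) w'.1).1),
      ‖klLipTransfer (b * L) M β μ K d k x
        ((klBlockEquiv L b M (sectorCount (d * k - 1))).symm ((klBlockEquiv L b M (sectorCount (d * k)) w'.1).1, y))‖ ≤ τ)
    (hτ₂ : w'.2 = 0 → ∑ B ∈ univ.erase (klBlockEquiv L b M (sectorCount (d * k)) w'.1).1, ∑ y,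
      ‖klLipTransfer (b * L) M β μ K d k w'.1 ((klBlockEquiv L b M (sectorCount (d * k - 1))).symm (B, y))‖ ≤ τ)
    (hτ₃ : w'.2 = 0 → ∑ y ∈ univ.filter (fun y : SpaceTimeIdx L M × SectorLeg (sectorCount (d * k - 1)) => ¬ Near y),
      ‖klLipTransfer (b * L) M β μ K d k w'.1
        ((klBlockEquiv L b M (sectorCount (d * k - 1))).symm ((klBlockEquiv L b M (sectorCount (d * k)) w'.1).1, y))‖ ≤ τ)
    (hW₃ : w'.2 = 1 → ∀ y, klPlainShift (b * L) M (sectorCount (d * k)) (sectorCount (d * k - 1)) w'.1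
        ((klBlockEquiv L b M (sectorCount (d * k - 1))).symm ((klBlockEquiv L b M (sectorCount (d * k)) w'.1).1, y)) ≠ 0 → Near y)
    (hτ₄ : ∀ y, ¬ Z y → ∑ B ∈ univ.erase (klBlockEquiv L b M (sectorCount (d * k)) w'.1).1,
      ∑ x ∈ univ.filter (fun x : SpaceTimeIdx (b * L) M × SectorLeg (sectorCount (d * k)) =>
          (klBlockEquiv L b M (sectorCount (d * k)) x).1 = (klBlockEquiv L b M (sectorCount (d * k)) w'.1).1),
        ‖klLipTransfer (b * L) M β μ K d k x ((klBlockEquiv L b M (sectorCount (d * k - 1))).symm (B, y))‖ ≤ τ)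
    (hN : ∀ y, ∑ Y ∈ univ.filter (fun Y : Fin (n + 1) → SrcLabel L M (d * k - 1) => Y p = y),
      ‖kernel ℂ (effAction ℂ (klLipCovD L M β μ K d k) (klLipInputD L M β U μ K d k) - klLipInputD L M β U μ K d k) (n + 1) Y‖ ≤ N)
    (hNfar : ∀ y (i : Fin (n + 1)),
      ∑ Y ∈ univ.filter (fun Y : Fin (n + 1) → SrcLabel L M (d * k - 1) => Y p = y ∧ Far (Y p).1 (Y i).1),
        ‖kernel ℂ (effAction ℂ (klLipCovD L M β μ K d k) (klLipInputD L M β U μ K d k) - klLipInputD L M β U μ K d k) (n + 1) Y‖ ≤ Nfar)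
    (hE : ∀ y', NearF y'.1 →
      ∑ Y' ∈ univ.filter (fun Y' : Fin (n + 1) → SrcLabel (b * L) M (d * k - 1) => Y' p = y'),
        ‖kernel ℂ ((effAction ℂ (klLipCovD (b * L) M β μ K d k) (klGlueD L b M (d * k - 1) (klLipInputD L M β U μ K d k)) -
              klGlueD L b M (d * k - 1) (klLipInputD L M β U μ K d k)) -
            klGlueD L b M (d * k - 1)
              (effAction ℂ (klLipCovD L M β μ K d k) (klLipInputD L M β U μ K d k) - klLipInputD L M β U μ K d k)) (n + 1) Y'‖ ≤ E)
    (hND : ∀ y',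
      ∑ Y' ∈ univ.filter (fun Y' : Fin (n + 1) → SrcLabel (b * L) M (d * k - 1) => Y' p = y'),
        ‖kernel ℂ ((effAction ℂ (klLipCovD (b * L) M β μ K d k) (klGlueD L b M (d * k - 1) (klLipInputD L M β U μ K d k)) -
              klGlueD L b M (d * k - 1) (klLipInputD L M β U μ K d k)) -
            klGlueD L b M (d * k - 1)
              (effAction ℂ (klLipCovD L M β μ K d k) (klLipInputD L M β U μ K d k) - klLipInputD L M β U μ K d k)) (n + 1) Y'‖ ≤ ND) :
    ∑ X' ∈ univ.filter (fun X' : Fin (n + 1) → SrcLabel (b * L) M (d * k) => X' p = w'),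
        ‖kernel ℂ (ExteriorAlgebra.map (Matrix.toLin' (klLipTransferD (b * L) M β μ K d k))
              (effAction ℂ (klLipCovD (b * L) M β μ K d k) (klGlueD L b M (d * k - 1) (klLipInputD L M β U μ K d k)) -
                klGlueD L b M (d * k - 1) (klLipInputD L M β U μ K d k)) -
            klGlueD L b M (d * k) (klLipBornD L M β U μ K d k)) (n + 1) X'‖ ≤
      a ^ n * (a * E + τ * ND) + (2 * a ^ n * τ * N + n * a ^ n * (5 * τ * N + 2 * a * Nfar)) := by
  classical
  have ha : 0 ≤ a := le_trans zero_le_one ha1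
  rw [klLipBornD_eq_map_step (V := L) hβ U μ K hdk hZc]
  have hmain := sum_norm_kernel_map_sub_glue_map_le_of_defect (𝕜 := ℂ)
    (klBlockEquivD L b M (d * k - 1)) (klBlockEquivD L b M (d * k))
    (klLipTransferD L M β μ K d k) (klLipTransferD (b * L) M β μ K d k) (fun X' Y => klLipTransferD_periodise hβ μ K d k X' Y)
    (klBlockEmbD L b M (d * k - 1)) (fun B v X' => klBlockEmbD_apply B v X')
    (klBlockEmbD L b M (d * k)) (fun B v X' => klBlockEmbD_apply B v X')
    (effAction ℂ (klLipCovD (b * L) M β μ K d k) (klGlueD L b M (d * k - 1) (klLipInputD L M β U μ K d k)) -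
      klGlueD L b M (d * k - 1) (klLipInputD L M β U μ K d k))
    (effAction ℂ (klLipCovD L M β μ K d k) (klLipInputD L M β U μ K d k) - klLipInputD L M β U μ K d k) p w'
    (fun Y : SrcLabel L M (d * k - 1) => Z Y.1) (fun Y : SrcLabel L M (d * k - 1) => Near Y.1)
    (fun Y Y' : SrcLabel L M (d * k - 1) => Far Y.1 Y'.1) (fun Y Y' hY hY' => hZ _ _ hY hY')
    (fun Y' : SrcLabel (b * L) M (d * k - 1) => NearF Y'.1)
    ha hτ0 hN0 hNfar0 hE0 hND0
    (colSum_doubleBlock_le _ _ _ (klLipTransferD_apply β μ K d k) hcol (colSum_norm_klPlainShift_le_one (sectorCount_pos _)) ha1)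
    (hwinD_le μ K d k ha1 hwin) (hrhoD_le μ K d k ha1 w' hρ)
    (by
      rcases Fin.exists_fin_two.1 ⟨w'.2, rfl⟩ with h | h
      · rw [rowSum_doubleBlock_filter_copy0 _ _ _ (klLipTransferD_apply β μ K d k) NearF w' h]; exact hrowF
      · exact (rowSum_doubleBlock_filter_copy1_le _ _ _ (klLipTransferD_apply β μ K d k)
          (fun x s => rowSum_norm_klPlainShift_le_one (sectorCount_pos _) x s) _ w' h).trans ha1)
    (by
      have h10 : ¬ ((1 : Fin 2) = 0) := by decide
      rcases Fin.exists_fin_two.1 ⟨w'.2, rfl⟩ with h | h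
      · rw [rowSum_doubleBlock_filter_copy0 _ _ _ (klLipTransferD_apply β μ K d k) (fun y => ¬ NearF y) w' h]; exact hτF
      · refine le_trans (le_of_eq (Finset.sum_eq_zero fun y' hy' => ?_)) hτ0
        rw [Finset.mem_filter] at hy'
        rw [klLipTransferD_apply, h]
        simp only [h10, false_and, if_false, true_and]
        by_cases hy2 : y'.2 = 1
        · rw [if_pos hy2, norm_eq_zero]
          by_contra hne
          exact hy'.2 (hWF h y'.1 hne)
        · rw [if_neg hy2, norm_zero])
    (htau1D_le μ K d k hτ0 w' Z hτ₁) (htau2D_le μ K d k hτ0 w' hτ₂) (htau3D_le μ K d k hτ0 w' Near hτ₃ hW₃) (htau4D_le μ K d k hτ0 w' Z hτ₄)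
    hN (fun Y i => hNfar Y i) (fun Y' hY' => hE Y' hY') hND
  refine Eq.trans_le (Finset.sum_congr rfl fun X' _ => ?_) hmain
  rw [kernel_sub', klGlueD_def (ExteriorAlgebra.map (Matrix.toLin' (klLipTransferD L M β μ K d k))
    (effAction ℂ (klLipCovD L M β μ K d k) (klLipInputD L M β U μ K d k) - klLipInputD L M β U μ K d k))]

end SourceDoorD

/-! ## D3b §4 The doubled source transfer door from E1's two weighted transfer sums (rows discharged) -/

section SourceDoorDRows

variable {L b M : ℕ} [NeZero L] [NeZero (b * L)] [NeZero M]

omit [NeZero L] [NeZero (b * L)] [NeZero M] in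
/-- The torus sup-norm of the zero site vanishes (local one-liner). [folklore] -/
private theorem tnorm_zero_locD {dd V : ℕ} [NeZero V] : Torus.tnorm (0 : TorusSite dd V) = 0 := by
  have h : Torus.tnorm (0 : TorusSite dd V) ≤ Site.supNorm (0 : Site dd) := by
    have h1 := Torus.tnorm_proj_le (L := V) (0 : Site dd)
    have h0 : Torus.proj V (0 : Site dd) = 0 := by
      funext i
      simp [Torus.proj_apply]
    rwa [h0] at h1
  have h2 : Site.supNorm (0 : Site dd) = 0 := Nat.le_zero.1 (Site.supNorm_le_iff.2 fun i => by simp)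
  exact Nat.le_zero.1 (h2 ▸ h)

set_option maxHeartbeats 400000 in -- the nine transfer data and the door in one declaration
/-- **THE DOUBLED SOURCE TRANSFER DOOR, ROWS DISCHARGED** (doubled twin of ✓ `klGlue_transfer_le_of_wtRows` ∘ `lipSourceTransfer_le_of_scaleWtRows`): from the two
`(1 + Λ_T·tnorm)`-weighted row / column sums `cW` (`1 ≤ cW`) of the block transfer `klLipTransfer (bL) = klJump (bL) (dk) (dk−1)` (periodisation ✓ `klJump_periodise`, block
covariance ✓ `norm_klJump_blockCovariant`), at a `(D₀ + r)`-deep pin `w′` of EITHER copy (`2r ≤ D₀`), the pinned profile of the doubled SOURCE is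
`≤ cWⁿ(cW·E + τ·ND) + (2cWⁿτN + n·cWⁿ(5τN + 2cW·N_far))`, `τ = cW/(1 + Λ_T(r+1))`, with `N, N_far` the plain / `r`-far pinned profiles of the coarse doubled born term and
`E, ND` the near / global profiles of the doubled source defect.  The plain-pin partner facts are discharged: the shift's partner sits at the SAME site (`tnorm 0 ≤ r`). -/
theorem lipSourceTransferD_le_of_wtRows {β : ℝ} (hβ : 0 < β) (U μ : ℝ) (K : TrigPolyC4v) {d k : ℕ} (hdk : 1 ≤ d * k)
    (hZc : hubbardEffPartitionFnCT L M β U μ 0 K (klScale klE0 (d * k)) ≠ 0)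
    {ΛT cW : ℝ} (hΛT : 0 ≤ ΛT) (hcW1 : 1 ≤ cW)
    (hrow : ∀ x : SpaceTimeIdx (b * L) M × SectorLeg (sectorCount (d * k)), ∑ y', ‖klLipTransfer (b * L) M β μ K d k x y'‖ *
      (1 + ΛT * (Torus.tnorm (x.1.2 - y'.1.2) : ℝ)) ≤ cW)
    (hcol : ∀ y' : SpaceTimeIdx (b * L) M × SectorLeg (sectorCount (d * k - 1)), ∑ x, ‖klLipTransfer (b * L) M β μ K d k x y'‖ *
      (1 + ΛT * (Torus.tnorm (x.1.2 - y'.1.2) : ℝ)) ≤ cW)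
    {n : ℕ} (p : Fin (n + 1)) (w' : SrcLabel (b * L) M (d * k)) (D₀ r : ℕ) (hD₀ : 2 * r ≤ D₀)
    (hw : ∀ i, D₀ + r ≤ (w'.1.1.2 i).val % L ∧ (w'.1.1.2 i).val % L + (D₀ + r) < L)
    {N Nfar E ND : ℝ} (hN0 : 0 ≤ N) (hNfar0 : 0 ≤ Nfar) (hE0 : 0 ≤ E) (hND0 : 0 ≤ ND)
    (hN : ∀ y, ∑ Y ∈ univ.filter (fun Y : Fin (n + 1) → SrcLabel L M (d * k - 1) => Y p = y),
      ‖kernel ℂ (effAction ℂ (klLipCovD L M β μ K d k) (klLipInputD L M β U μ K d k) - klLipInputD L M β U μ K d k) (n + 1) Y‖ ≤ N)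
    (hNfar : ∀ y (i : Fin (n + 1)),
      ∑ Y ∈ univ.filter (fun Y : Fin (n + 1) → SrcLabel L M (d * k - 1) => Y p = y ∧ r < Torus.tnorm ((Y p).1.1.2 - (Y i).1.1.2)),
        ‖kernel ℂ (effAction ℂ (klLipCovD L M β μ K d k) (klLipInputD L M β U μ K d k) - klLipInputD L M β U μ K d k) (n + 1) Y‖ ≤ Nfar)
    (hE : ∀ y' : SrcLabel (b * L) M (d * k - 1), Torus.tnorm (w'.1.1.2 - y'.1.1.2) ≤ r →
      ∑ Y' ∈ univ.filter (fun Y' : Fin (n + 1) → SrcLabel (b * L) M (d * k - 1) => Y' p = y'),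
        ‖kernel ℂ ((effAction ℂ (klLipCovD (b * L) M β μ K d k) (klGlueD L b M (d * k - 1) (klLipInputD L M β U μ K d k)) -
              klGlueD L b M (d * k - 1) (klLipInputD L M β U μ K d k)) -
            klGlueD L b M (d * k - 1)
              (effAction ℂ (klLipCovD L M β μ K d k) (klLipInputD L M β U μ K d k) - klLipInputD L M β U μ K d k)) (n + 1) Y'‖ ≤ E)
    (hND : ∀ y',
      ∑ Y' ∈ univ.filter (fun Y' : Fin (n + 1) → SrcLabel (b * L) M (d * k - 1) => Y' p = y'),
        ‖kernel ℂ ((effAction ℂ (klLipCovD (b * L) M β μ K d k) (klGlueD L b M (d * k - 1) (klLipInputD L M β U μ K d k)) -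
              klGlueD L b M (d * k - 1) (klLipInputD L M β U μ K d k)) -
            klGlueD L b M (d * k - 1)
              (effAction ℂ (klLipCovD L M β μ K d k) (klLipInputD L M β U μ K d k) - klLipInputD L M β U μ K d k)) (n + 1) Y'‖ ≤ ND) :
    ∑ X' ∈ univ.filter (fun X' : Fin (n + 1) → SrcLabel (b * L) M (d * k) => X' p = w'),
        ‖kernel ℂ (ExteriorAlgebra.map (Matrix.toLin' (klLipTransferD (b * L) M β μ K d k))
              (effAction ℂ (klLipCovD (b * L) M β μ K d k) (klGlueD L b M (d * k - 1) (klLipInputD L M β U μ K d k)) -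
                klGlueD L b M (d * k - 1) (klLipInputD L M β U μ K d k)) -
            klGlueD L b M (d * k) (klLipBornD L M β U μ K d k)) (n + 1) X'‖ ≤
      cW ^ n * (cW * E + cW / (1 + ΛT * ((r : ℝ) + 1)) * ND) +
        (2 * cW ^ n * (cW / (1 + ΛT * ((r : ℝ) + 1))) * N + n * cW ^ n * (5 * (cW / (1 + ΛT * ((r : ℝ) + 1))) * N + 2 * cW * Nfar)) := by
  classical
  haveI : NeZero b := ⟨fun h => NeZero.ne (b * L) (by rw [h, zero_mul])⟩
  have hβ0 : β ≠ 0 := hβ.ne'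
  have hcW : 0 ≤ cW := le_trans zero_le_one hcW1
  set T' := klLipTransfer (b * L) M β μ K d k with hT'
  set ed := klBlockEquiv L b M (sectorCount (d * k)) with hed_def
  set ed₁ := klBlockEquiv L b M (sectorCount (d * k - 1)) with hed₁_def
  have hed1 : ∀ (x : SpaceTimeIdx (b * L) M × SectorLeg (sectorCount (d * k))) i, ((ed x).1 i : ℕ) = (x.1.2 i).val / L :=
    fun x i => klBlockEquiv_val L b M _ x i
  have hed₁1 : ∀ (y' : SpaceTimeIdx (b * L) M × SectorLeg (sectorCount (d * k - 1))) i, ((ed₁ y').1 i : ℕ) = (y'.1.2 i).val / L :=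
    fun y' i => klBlockEquiv_val L b M _ y' i
  have hed2s : ∀ x : SpaceTimeIdx (b * L) M × SectorLeg (sectorCount (d * k)),
      (fun Y : SpaceTimeIdx L M × SectorLeg (sectorCount (d * k)) => Y.1.2) (ed x).2 = fun i => ((((x.1.2 i).val : ℕ)) : ZMod L) := fun x => by
    dsimp only; rw [hed_def, klBlockEquiv_snd]
  have hed₁2s : ∀ y' : SpaceTimeIdx (b * L) M × SectorLeg (sectorCount (d * k - 1)),
      (fun Y : SpaceTimeIdx L M × SectorLeg (sectorCount (d * k - 1)) => Y.1.2) (ed₁ y').2 = fun i => ((((y'.1.2 i).val : ℕ)) : ZMod L) := fun y' => by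
    dsimp only; rw [hed₁_def, klBlockEquiv_snd]
  have hcov : ∀ (δ B' B : Fin 2 → Fin b) (xbar : SpaceTimeIdx L M × SectorLeg (sectorCount (d * k))) (y : SpaceTimeIdx L M × SectorLeg (sectorCount (d * k - 1))),
      ‖T' (ed.symm (B' + δ, xbar)) (ed₁.symm (B + δ, y))‖ = ‖T' (ed.symm (B', xbar)) (ed₁.symm (B, y))‖ :=
    fun δ B' B xbar y => norm_klJump_blockCovariant hβ0 μ K (d * k) (d * k - 1) δ B' B xbar y
  have hτT : 0 ≤ cW / (1 + ΛT * ((r : ℝ) + 1)) := by positivity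
  have hTcol := transfer_col_le (fun x : SpaceTimeIdx (b * L) M × SectorLeg (sectorCount (d * k)) => x.1.2)
    (fun y' : SpaceTimeIdx (b * L) M × SectorLeg (sectorCount (d * k - 1)) => y'.1.2) T' hΛT hcol
  have hTwin := transfer_win_le (fun x : SpaceTimeIdx (b * L) M × SectorLeg (sectorCount (d * k)) => x.1.2)
    (fun y' : SpaceTimeIdx (b * L) M × SectorLeg (sectorCount (d * k - 1)) => y'.1.2) T' hΛT hcol ed ed₁ hcov
  have hTρ := transfer_rho_le (fun x : SpaceTimeIdx (b * L) M × SectorLeg (sectorCount (d * k)) => x.1.2)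
    (fun y' : SpaceTimeIdx (b * L) M × SectorLeg (sectorCount (d * k - 1)) => y'.1.2) T' hΛT hrow ed ed₁
  have hTrowF := transfer_rowF_le (fun x : SpaceTimeIdx (b * L) M × SectorLeg (sectorCount (d * k)) => x.1.2)
    (fun y' : SpaceTimeIdx (b * L) M × SectorLeg (sectorCount (d * k - 1)) => y'.1.2) T' hΛT hrow r
  have hTτF := transfer_tauF_le (fun x : SpaceTimeIdx (b * L) M × SectorLeg (sectorCount (d * k)) => x.1.2)
    (fun y' : SpaceTimeIdx (b * L) M × SectorLeg (sectorCount (d * k - 1)) => y'.1.2) T' hΛT hrow hcW (le_refl r)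
  have hTτ2 := transfer_tau2_le (fun x : SpaceTimeIdx (b * L) M × SectorLeg (sectorCount (d * k)) => x.1.2)
    (fun y' : SpaceTimeIdx (b * L) M × SectorLeg (sectorCount (d * k - 1)) => y'.1.2) T' hΛT hrow hcW (rfl : b * L = b * L) ed ed₁ hed1 hed₁1
    (Nat.le_add_left r D₀) w'.1 hw
  have hTτ3 := transfer_tau3_le (fun x : SpaceTimeIdx (b * L) M × SectorLeg (sectorCount (d * k)) => x.1.2)
    (fun y' : SpaceTimeIdx (b * L) M × SectorLeg (sectorCount (d * k - 1)) => y'.1.2) T' hΛT hrow hcW (rfl : b * L = b * L) ed ed₁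
    (fun Y : SpaceTimeIdx L M × SectorLeg (sectorCount (d * k)) => Y.1.2) (fun Y : SpaceTimeIdx L M × SectorLeg (sectorCount (d * k - 1)) => Y.1.2)
    hed2s hed₁2s (le_refl r) w'.1
  have hTτ1 := transfer_tau1_le (fun x : SpaceTimeIdx (b * L) M × SectorLeg (sectorCount (d * k)) => x.1.2)
    (fun y' : SpaceTimeIdx (b * L) M × SectorLeg (sectorCount (d * k - 1)) => y'.1.2) T' hΛT hcol (rfl : b * L = b * L) ed ed₁ hed1 hed₁1
    (fun Y : SpaceTimeIdx L M × SectorLeg (sectorCount (d * k)) => Y.1.2) (fun Y : SpaceTimeIdx L M × SectorLeg (sectorCount (d * k - 1)) => Y.1.2)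
    hed2s hed₁2s (RZ := 2 * r) (by omega : r + 2 * r ≤ D₀ + r) w'.1 hw
  have hTτ4 := transfer_tau4_le (fun x : SpaceTimeIdx (b * L) M × SectorLeg (sectorCount (d * k)) => x.1.2)
    (fun y' : SpaceTimeIdx (b * L) M × SectorLeg (sectorCount (d * k - 1)) => y'.1.2) T' hΛT hcol (rfl : b * L = b * L) ed ed₁ hed1 hed₁1
    (fun Y : SpaceTimeIdx L M × SectorLeg (sectorCount (d * k)) => Y.1.2) (fun Y : SpaceTimeIdx L M × SectorLeg (sectorCount (d * k - 1)) => Y.1.2)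
    hed2s hed₁2s hcov (RZ := 2 * r) (by omega : r + 2 * r ≤ D₀ + r) w'.1 hw
  have hZT : ∀ y y' : SpaceTimeIdx L M × SectorLeg (sectorCount (d * k - 1)), Torus.tnorm ((ed w'.1).2.1.2 - y.1.2) ≤ r →
      2 * r < Torus.tnorm ((ed w'.1).2.1.2 - y'.1.2) → r < Torus.tnorm (y.1.2 - y'.1.2) := by
    intro y y' hy hy'
    have htri := Torus.tnorm_add_le ((ed w'.1).2.1.2 - y.1.2) (y.1.2 - y'.1.2)
    rw [sub_add_sub_cancel] at htri; omega
  -- the plain-pin partner facts: the shift's partner sits at the SAME site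
  have hWF : w'.2 = 1 → ∀ y', klPlainShift (b * L) M (sectorCount (d * k)) (sectorCount (d * k - 1)) w'.1 y' ≠ 0 → Torus.tnorm (w'.1.1.2 - y'.1.2) ≤ r := by
    intro _ y' hne
    rw [klPlainShift_ne_zero_site hne, sub_self, tnorm_zero_locD]; exact Nat.zero_le _
  have hW₃ : w'.2 = 1 → ∀ y, klPlainShift (b * L) M (sectorCount (d * k)) (sectorCount (d * k - 1)) w'.1 (ed₁.symm ((ed w'.1).1, y)) ≠ 0 →
      Torus.tnorm ((ed w'.1).2.1.2 - y.1.2) ≤ r := by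
    intro _ y hne
    have hs := klPlainShift_ne_zero_site hne
    have h2 : (ed w'.1).2.1.2 = y.1.2 := by
      have hy : (ed₁ (ed₁.symm ((ed w'.1).1, y))).2 = y := by rw [Equiv.apply_symm_apply]
      rw [hed₁_def, klBlockEquiv_snd, ← hs] at hy
      rw [hed_def, klBlockEquiv_snd, ← hy]
    rw [h2, sub_self, tnorm_zero_locD]; exact Nat.zero_le _
  exact lipSourceTransferD_le hβ0 U μ K hdk hZc p w' (fun y => 2 * r < Torus.tnorm ((ed w'.1).2.1.2 - y.1.2))
    (fun y => Torus.tnorm ((ed w'.1).2.1.2 - y.1.2) ≤ r) (fun y y' => r < Torus.tnorm (y.1.2 - y'.1.2)) hZT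
    (fun y' => Torus.tnorm (w'.1.1.2 - y'.1.2) ≤ r) hcW1 hτT hN0 hNfar0 hE0 hND0 hTcol hTwin (fun _ => hTρ w'.1) (hTrowF w'.1) (hTτF w'.1) hWF
    (fun y hy => hTτ1 y hy) (fun _ => hTτ2) (fun _ => hTτ3) hW₃ (fun y hy => hTτ4 y hy) hN hNfar hE hND

end SourceDoorDRows

end Summit.HubbardSuperconductivity.HubbardSuperconductivity.Theorems.TwoVolumeLip

end
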